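import Summits.NavierStokesRegularity.NavierStokesRegularity.Theses.GaldiLiouvilleGate
import Summits.NavierStokesRegularity.NavierStokesRegularity.Theorems.GaldiLiouvilleGateParabolicGaldiLiouvilleStubSobolevSixFrobenius
import Summits.NavierStokesRegularity.NavierStokesRegularity.Theorems.GaldiLiouvilleGateParabolicGaldiLiouvilleStubLpsOfSobolev
import Summits.NavierStokesRegularity.NavierStokesRegularity.Theorems.GaldiLiouvilleGateParabolicGaldiLiouvilleStubLpsSixFourOfSobolev
import Summits.NavierStokesRegularity.NavierStokesRegularity.Theorems.GaldiLiouvilleGateParabolicGaldiLiouvilleDecayRung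
import Summits.NavierStokesRegularity.NavierStokesRegularity.Theorems.GaldiLiouvilleGateParabolicGaldiLiouvilleStubOseenMildOfL6
import Summits.NavierStokesRegularity.NavierStokesRegularity.Theorems.GaldiLiouvilleGateParabolicGaldiLiouvilleStubL6Stability
import Literature.Analysis.FluidPDE.AncientLPSLiouvilleProofs
import Literature.Analysis.FluidPDE.AncientL3BackwardLiouvilleHolds
import HarnessLib.Audit

/-!
# Birth skeleton (BC3) of the crux `GaldiLiouvilleGate.ParabolicGaldiLiouville`

(crux item `stmt-NavierStokesRegularity-0893`, rank 2, route
`route-NavierStokesRegularity-GaldiLiouvilleGate`; tree path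
`Cruxes/ParabolicGaldiLiouville/Lines/birth.lean`; registrar
`planner-skel-stmt-NavierStokesRegularity-0893-0`, 2026-08-17. The route predates the Lean birth
certificate; this file supplies BC3 retroactively.)

THE CRUX (X2, "parabolic Galdi–Liouville"). A smooth bounded ancient mild solution `v` of
Navier–Stokes (`ν = 1`) on `ℝ³ × (−∞,0)` with `sup_{s<0} ∫ |∇v(s)|² < ∞` and `v(s) ∈ L⁶` for every
`s < 0` vanishes identically.

THE CUT — the DISSIPATION GATE. X2 is an *infrared* Liouville problem (bounded enstrophy is
subcritical in the small and says nothing as `s → −∞` / `|y| → ∞`; its steady case is Leray's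
D-solution Liouville problem, crux `GaldiLiouville`). The one space–time quantity that converts
the time-UNIFORM class of X2 into a class where a Liouville theorem is PROVED in the tree is the
TOTAL DISSIPATION `∫_{−∞}^{0} ∫ |∇v|² dy ds`:

* `stub_finiteDissipation` [XL, OPEN — the load-bearing infrared gain]: in the class of X2 the
  total dissipation `∫_{s<0} ∫ |∇v(s)|²` is FINITE. Its steady case is exactly `GaldiLiouville`
  (a steady D-solution dissipates at the constant rate `ν ∫|∇U|²`, finite in total iff `∇U ≡ 0`
  iff `U ≡ 0` given `U → 0`); for a Type-I-like ancient flow shifted by one time unit it is the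
  statement that the enstrophy `~ (−s)^{-1/2}` is NOT the true infrared behaviour. Why it might
  fail: a nontrivial D-solution, or an ancient flow with enstrophy decaying like `(−s)^{-a}`,
  `a ≤ 1`, refutes it — the same witnesses that refute X2 (kill criterion of the route).
* `stub_lpsOfFiniteDissipation` [M/L, real analysis, believed PROVABLE now]: a bounded field,
  smooth on `(−∞,0) × ℝ³`, with `L⁶` slices and finite total dissipation has a finite
  Ladyzhenskaya–Prodi–Serrin quantity at the exponents `(s, l) = (9, 3)` (`3/9 + 2/3 = 1`):
  `∫_{t<0} ‖v(t)‖_{L⁹}^3 dt < ∞`. Mechanism: slice-wise Sobolev `‖v(t)‖₆ ≤ C_S ‖∇v(t)‖₂` (the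
  `L⁶` hypothesis excludes the constants; density/truncation version of Mathlib's
  `MeasureTheory.eLpNorm_le_eLpNorm_fderiv_of_eq`), interpolation
  `‖v(t)‖₉³ ≤ ‖v(t)‖₆² ‖v‖_∞`, Tonelli in time. No Navier–Stokes input.

RESHAPING (lead c1, 2026-08-17): stub 2 is split at the skeleton level into the pure Sobolev
inequality `stub_sobolevSixFrobenius` (2a) and the bookkeeping implication `stub_lpsOfSobolev`
(2b, which takes 2a's statement as an explicit hypothesis). WAVE 1 LANDED BOTH (p148385, p146741:
`Theorems/GaldiLiouvilleGateParabolicGaldiLiouvilleStub{SobolevSixFrobenius,LpsOfSobolev}.lean`), so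
the birth stub 2 is now the closed THEOREM `lpsOfFiniteDissipation` and the skeleton's only
placeholder is `stub_finiteDissipation` (= the crux's open content; steady case = crux 0895).

RESHAPING 2 (lead c1, cycle 2, 2026-08-17) — THE SHARP GATE. Among the LPS classes reachable from
`L^∞ ∩ L⁶ ∩ Ḣ¹` slices, `‖v(t)‖_p^l ≤ ‖v‖_∞^{l(1−6/p)} (K² E(t))^{3l/p}`, `l = 2p/(p−3)`,
`E(t) = ∫|∇v(t)|_F²`, `p ∈ [6, ∞)`: the time integrand is `E(t)^{6/(p−3)}` and, `E` being bounded,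
the HIGHEST power is the WEAKEST requirement — `p = 6`, `l = 4`, integrand `E(t)²`. So the open
stub is weakened from finite dissipation `∫_{s<0} E(s) ds < ∞` (birth stub 1) to
SQUARE-INTEGRABLE ENSTROPHY `∫_{s<0} E(s)² ds < ∞` (`stub_sqIntegrableEnstrophy`; implied by the
old stub since `E ≤ C`, `sqIntegrableEnstrophy_of_finiteDissipation`), fed to Seregin's theorem at
`(s, l) = (6, 4)` through the landed bookkeeping `stub_lpsSixFourOfSobolev` (p152008; slice-wise
`‖v(t)‖₆⁴ ≤ K⁴ E(t)²` from the landed 2a; boundedness is not even used there). The threshold of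
the new gate is exactly the SELF-SIMILAR rate: `E(s) ≲ (−s)^{-a}` with `a > 1/2` closes X2 for
that flow, `a = 1/2` (Type I, backward self-similar) is the borderline that fails
logarithmically. The new stub still contains crux 0895 (steady `E ≡ const`), and the crux still
implies it (`sqIntegrableEnstrophy_of_crux`): X2 ⇔ square-integrable enstrophy in the class of X2.

RESHAPING 3 (lead c2, cycle 3, 2026-08-17) — THE TWO-GATE SKELETON. The tree PROVES a second
Liouville theorem usable in the class, at a CRITICAL TIME-UNIFORM level instead of a
time-integrated one: Albritton–Barker 2019, Thm 1.2
(`Literature.Analysis.FluidPDE.AlbrittonBarker2019_liouville_L3_backward_holds`): a bounded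
ancient solution of the Oseen INTEGRAL EQUATION `v(t) = e^{(t−s)Δ}v(s) − B¹ₛ(v,v)(t)` whose `L³`
norms stay bounded along ONE sequence of times `τ_k → −∞` vanishes identically. The X2 class is
stated in the tree's duality ("very weak") form `IsBoundedAncientMildSolution 1 v`, which does
not see KNSS's parasitic drifts `b(t)`; but its slices are uniformly in `L⁶`
(`‖v(s)‖₆ ≤ K √C` from the landed 2a and the enstrophy bound), and a constant drift increment
`b(t) − b(s)` that lies in `L⁶(ℝ³)` vanishes (KNSS 2009, Lemma 3.1 in drift-mild form + the
finite-`L^p` exclusion of the parasitic solutions, §1 p. 3; tree template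
`BoundedL2ClassicalMild.mild_of_bounded_of_eLpNorm_two_le_of_lt`, `2 ↦ 6`). Hence the new
PROVABLE transfer stub `stub_oseenMildOfL6` (the X2 class solves the Oseen integral equation),
and the open stub is WEAKENED to the disjunction `stub_twoGate`: every flow of the class passes
the `(6,4)` gate (`∫E² < ∞`) OR the backward-`L³` gate (`sup_k ‖v(τ_k)‖₃ < ∞` along some
`τ_k → −∞`). The two gates are incomparable (the first forces `E → 0` on average as `s → −∞`
but no `L³` slice; the second allows steady/periodic behaviour but needs one critical norm
bounded backward), so the disjunction is strictly weaker than either; it is still crux-sized —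
its steady case is `GaldiLiouville` (0895): a steady inhabitant has constant `E`, and `U ∈ L³`
for a D-solution is Galdi's `L^{9/2}` criterion — and X2 implies it (`twoGate_of_crux`).
COMPOSITION (`parabolicGaldiLiouville_of_hyps_twoGate`, closed): case 1 → the `(6,4)` chain
below; case 2 → `stub_oseenMildOfL6` puts `v` in Albritton–Barker's class and Thm 1.2 gives
`v t x = 0` for all `t < 0`, `x` directly. `ParabolicGaldiLiouville_of` concludes the crux BY
NAME from `stub_twoGate`, `stub_oseenMildOfL6` (registered) and the landed 2a/2b′.

RESHAPING 4 (lead c2, cycle 3, 2026-08-17) — THE SHARP TWO-GATE SKELETON. With the class now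
Oseen-mild (stub O landed, p164272) the tree's small-data `L⁶` WINDOW STABILITY
(`IsKNSSDriftMild.exists_eta_ae_eLpNorm_le_four_mul`, the engine of its proof of Seregin's
Thm 4.12, at `p = 6`: `‖v(s)‖₆ |s|^{1/4} ≤ η ⇒ ‖v(t)‖₆ ≤ 4‖v(s)‖₆` a.e. on `(s,0)`) applies with
ZERO drift (`stub_l6Stability`, provable), and gate 1 is SHARPENED from the time-integrated
`∫E² < ∞` to the SELF-SIMILAR-RATE LIMINF condition GATE A: `liminf_{σ→−∞} |σ| ‖v(σ)‖₆⁴ = 0`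
(one dip below the backward self-similar envelope per scale, with vanishing constant; implied by
gate 1 through the selection of good early times, `gateA_of_sqIntegrableEnstrophy`). The open
stub becomes `stub_sharpTwoGate` = gate A ∨ gate B; `ParabolicGaldiLiouville_of` goes through
`parabolicGaldiLiouville_of_hyps_sharpTwoGate`. Consequence recorded for the disprover: a
counterexample to X2 keeps `‖v(σ)‖₆ ≥ η|σ|^{-1/4}` and `E(σ) ≥ (η/K)²|σ|^{-1/2}` at ALL early
times and has `‖v(τ)‖₃ → ∞` along every backward sequence.

CYCLE 4 (lead c3, 2026-08-17) — THE LINE IS AT ITS FIXED POINT; THE TYPE-I BRIDGE. No reshaping: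
the skeleton is unchanged (one open stub, `stub_sharpTwoGate`). Two supports landed.
(i) FIXED-POINT CERTIFICATE (`Theorems/GaldiLiouvilleGateParabolicGaldiLiouvilleFixedPoint.lean`,
p172200): each of the four open stubs the line has carried — finite dissipation (birth), `∫E² < ∞`
(reshaping 2), two-gate (3), sharp two-gate (4) — is EQUIVALENT to the crux
(`parabolicGaldiLiouville_iff_finiteDissipation`, `…_iff_sqIntegrableEnstrophy`, `…_iff_twoGate`,
`…_iff_sharpTwoGate`): every stub is a property `P(v)` with `P(0)` true, asserted on the X2
class, so X2 implies it, and the landed gates give the converse. Hence no reshaping INSIDE this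
line changes its open content, which is X2 itself, and X2 ⊇ crux 0895 `GaldiLiouville`
(`galdiLiouville_of_sharpTwoGate`, p166404; Leray 1933; "remains open, even for axisymmetric
D-solutions" — Wang–Yang, arXiv:2608.06040 (2026), abstract). (ii) TYPE-I BRIDGE
(`Theorems/GaldiLiouvilleGateParabolicGaldiLiouvilleTypeIBridge.lean`, p172311):
`typeIAncient_eq_zero_of_parabolicGaldiLiouville` — X2 implies the Liouville theorem for SMOOTH
SPACE–TIME TYPE-I ANCIENT FLOWS (ancient mild `u`, jointly smooth, `‖u‖ ≤ C₀/(‖x‖+√(−t))`,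
`|∇u|_F² ≤ C₁/(‖x‖+√(−t))⁴` ⇒ `u ≡ 0`; every time translate `u(· − T)` inhabits the X2 class), and
its contrapositive `ParabolicGaldiLiouville_false_of_nontrivial_typeIAncient` (the cross-route
coupling with stmt-0155 / `TypeIDSSLiouvilleConjecture` noted by refuter f31d8029, up to the KNSS
regularity and gradient decay of the witness). So the residue of the two gates splits into two
OPEN problems that X2 contains: the steady one (0895) and the exclusion of smooth Type-I ancient
flows. The lead's verdict: the crux is blocked on 0895 (necessary, Lean-certified; not known to
be sufficient).

COMPOSITION (`parabolicGaldiLiouville_of_hyps`, closed, ≈ 45 lines; the birth composition,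
kept; `ParabolicGaldiLiouville_of` now goes through `parabolicGaldiLiouville_of_hyps_sharpTwoGate`): stub 1 ∘ stub 2 put `v` in
`L³_t L⁹_x((−∞,0) × ℝ³)`; the tree's PROVED Seregin Liouville theorem for bounded ancient
solutions with a finite LPS quantity
(`Literature.Analysis.FluidPDE.Seregin2014_ancient_liouville_LPS_holds`, Seregin 2014 Lecture
Notes Ch. 6 Thm 4.12, transferred to the duality-form mild class by
`Seregin2014_ancient_liouville_LPS.of_isBoundedAncientMildSolution`) gives `v(t,·) = 0` a.e. for
a.e. `t < 0`; joint continuity upgrades this to `v s y = 0` for every `s < 0`, `y`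
(`eq_zero_of_ae_of_continuousOn`: continuous slices are determined by their a.e. class, and a
non-zero value at `(s,y)` would persist on a time-neighbourhood of positive Lebesgue measure).

BC3 PROBES (registrar folder `bc/probe_stub*.lean`, `lean check`): for each stub `S`,
`S → ParabolicGaldiLiouville`, `S → NavierStokesRegularity` and `S → ¬NavierStokesRegularity` by
`first | exact? | simpa | simpa [ParabolicGaldiLiouville] | aesop | …` all FAIL (quoted in
`Lines/birth.md`): no stub is cheaply the crux or the summit. Stub 1 implies the crux only
through stub 2 AND Seregin's theorem (≈ 3 kloc of landed analysis); stub 2 carries no Liouville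
content at all.

Disproof used: none on file (`Cruxes/ParabolicGaldiLiouville/` had no `Disproof.lean` and no
`Negative/` lemma at registration; `ledger negatives` consulted — no refuted statement of the
summit is an instance of either stub). Cross-route bookkeeping honoured (refuter f31d8029 note
on the item): a Type-I DSS ancient profile shifted by one time unit would refute stub 1 exactly as
it refutes X2 — stub 1 is where that witness bites, by design.
-/

noncomputable section

open Set MeasureTheory MeasureTheory.Measure Filter Topology Function
open scoped ENNReal NNReal
open Literature.Analysis.FluidPDE

namespace Summit.NavierStokesRegularity.NavierStokesRegularity.Cruxes.ParabolicGaldiLiouville.Birth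

set_option linter.unusedVariables false
set_option linter.dupNamespace false

/-- **stub T♯ — `stub_sharpTwoGate` (XL, OPEN; reshaping 4 of lead c2; replaces and WEAKENS
`stub_twoGate` of reshaping 3, whose first disjunct `∫E² < ∞` implies gate A below by the
selection of good early times).** In the class of the crux (bounded ancient mild solution of NS
with `ν = 1`, smooth on `(−∞,0) × ℝ³`, uniformly bounded enstrophy, `L⁶` slices) every flow
passes at least one of the two gates the tree can close:
* GATE A — the SELF-SIMILAR-RATE LIMINF GATE: `liminf_{σ→−∞} |σ| · ‖v(σ)‖_{L⁶}⁴ = 0`, i.e. for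
  every `ε > 0` and `R > 0` there is a time `σ < −R` with `‖v(σ)‖₆⁴ |σ| < ε` (the flow dips
  below the backward self-similar envelope `‖v(σ)‖₆ ~ |σ|^{-1/4}`, `E(σ) ~ |σ|^{-1/2}`, with an
  arbitrarily small constant, at arbitrarily early times — ONE dip per scale suffices); closed by
  small-data `L⁶` stability in the Oseen class (`stub_l6Stability`): from such a dip the `L⁶`
  norm stays `≤ 4 ×` small up to time `0`;
* GATE B — the BACKWARD-`L³` GATE: the `L³` norms stay bounded along one sequence of times
  `τ_k → −∞`; closed by Albritton–Barker 2019 Thm 1.2 (landed rung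
  `parabolicGaldiLiouville_L3Corner`, p164882).
So a counterexample to X2 must keep `‖v(σ)‖₆ ≥ η |σ|^{-1/4}` (hence `E(σ) ≥ (η/K)² |σ|^{-1/2}`)
for ALL early times AND have `‖v(τ)‖₃ → ∞` along every backward sequence. Steady case =
`GaldiLiouville` (crux 0895): `‖U‖₆` is a nonzero constant (fails A) unless `U = 0`, and
`U ∈ L³` (gate B) is inside Galdi's `L^{9/2}` criterion. -/
theorem stub_sharpTwoGate :
    ∀ v : ℝ → EuclideanSpace ℝ (Fin 3) → EuclideanSpace ℝ (Fin 3),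
      Literature.Analysis.FluidPDE.IsBoundedAncientMildSolution 1 v →
      ContDiffOn ℝ (⊤ : ℕ∞) (Function.uncurry v) (Set.Iio 0 ×ˢ Set.univ) →
      (∃ C : NNReal, ∀ s < 0, ∫⁻ y, ENNReal.ofReal
          (Literature.Analysis.FluidPDE.frobeniusNormSq (fderiv ℝ (v s) y)) ≤ C) →
      (∀ s < 0, MeasureTheory.MemLp (v s) 6 MeasureTheory.volume) →
      (∀ ε : ENNReal, 0 < ε → ∀ R : ℝ, 0 < R → ∃ σ : ℝ, σ < -R ∧
        MeasureTheory.eLpNorm (v σ) 6 MeasureTheory.volume ^ (4 : ℝ) * ENNReal.ofReal (-σ) < ε) ∨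
      (∃ (τ : ℕ → ℝ) (M : ENNReal), M < ⊤ ∧ Filter.Tendsto τ Filter.atTop Filter.atBot ∧
        (∀ k, τ k < 0) ∧ ∀ k, MeasureTheory.eLpNorm (v (τ k)) 3 MeasureTheory.volume ≤ M) := by
  sorry

/-- **stub S — `stub_l6Stability` — LANDED** (p165798, wave 2 of lead c2,
`Theorems/GaldiLiouvilleGateParabolicGaldiLiouvilleStubL6Stability.lean`, 207 lines, with the
reusable `L6Stability.isKNSSDriftMild_of_eqOn_window`): **small-data `L⁶` stability up to the
final time, in the Oseen class.** There is a universal `η > 0` such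
that for every bounded ancient mild solution `v` (`ν = 1`, duality form), continuous on
`(−∞,0) × ℝ³` with uniformly-`L⁶` slices, and every `s < 0` with `‖v(s)‖_{L⁶} · |s|^{1/4} ≤ η`,
one has `‖v(t)‖_{L⁶} ≤ 4 ‖v(s)‖_{L⁶}` for a.e. `t ∈ (s, 0)`. Mechanism: the class is Oseen-mild
(landed `stub_oseenMildOfL6`), so on the window `(s − 1, 0)` shifted to `(0, 1 − s)` the field
(measurable representative, ZERO drift) is drift-mild in the sense of KNSS Lemma 3.1
(`IsKNSSDriftMild`, with `driftDuhamel_zero_eq_oseenDuhamel`); its window LPS quantity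
`∫ ‖v‖₆⁴` is finite by the uniform `L⁶` bound; the tree's window stability theorem
`IsKNSSDriftMild.exists_eta_ae_eLpNorm_le_four_mul` at `p = 6` (`1/2 − 3/(2·6) = 1/4`, any
`l > 2`) gives the claim, transported back by the time shift. -/
theorem stub_l6Stability :
    ∃ η : ENNReal, 0 < η ∧
      ∀ v : ℝ → EuclideanSpace ℝ (Fin 3) → EuclideanSpace ℝ (Fin 3),
        Literature.Analysis.FluidPDE.IsBoundedAncientMildSolution 1 v →
        ContinuousOn (Function.uncurry v) (Set.Iio 0 ×ˢ Set.univ) →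
        (∃ K : NNReal, ∀ s < 0, MeasureTheory.eLpNorm (v s) 6 MeasureTheory.volume ≤ K) →
        ∀ s : ℝ, s < 0 →
          MeasureTheory.eLpNorm (v s) 6 MeasureTheory.volume * ENNReal.ofReal ((-s) ^ (1 / 4 : ℝ)) ≤ η →
          ∀ᵐ t ∂(MeasureTheory.volume.restrict (Set.Ioo s 0)),
            MeasureTheory.eLpNorm (v t) 6 MeasureTheory.volume ≤
              4 * MeasureTheory.eLpNorm (v s) 6 MeasureTheory.volume :=
  Theorems.ParabolicGaldiLiouville.Birth.stub_l6Stability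

/-- **stub O — `stub_oseenMildOfL6` — LANDED** (p164272, wave 1 of lead c2,
`Theorems/GaldiLiouvilleGateParabolicGaldiLiouvilleStubOseenMildOfL6.lean`, 393 lines, with the
reusable window theorem `OseenMildOfL6.oseenMild_window`). A bounded ancient mild solution of NS (`ν = 1`) in the tree's duality
form, continuous on `(−∞,0) × ℝ³`, whose slices are UNIFORMLY in `L⁶` (`‖v(s)‖_{L⁶} ≤ K` for all
`s < 0`), solves the Oseen integral equation `v(t) = e^{(t−s)Δ}v(s) − B¹ₛ(v,v)(t)` pointwise for
all `s < t < 0`. Mechanism: on each window, duality-mild ⇒ bounded weak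
(`IsBoundedAncientMildSolution.isBoundedWeakNSSolutionOn`), KNSS 2009 Lemma 3.1 in drift-mild
form (`KNSS2009_weak_driftMild_holds`) writes `v = U + b(t)` a.e.; at good times the drift-free
right-hand side `e^{(t′−r)Δ}v(r) − B¹ᵣ(v,v)(t′)` lies in `L⁶(ℝ³)` (heat flow contracts `L⁶`;
Minkowski in time with the `L⁶ → L⁶` Oseen slice bound `≲ (t′−σ)^{-1/2}` applied to
`‖ |v||v| ‖₆ ≤ ‖v‖_∞ ‖v‖₆`), so the constant `b(r₂) − b(r₁) ∈ L⁶(ℝ³)` vanishes; continuity in time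
upgrades good pairs to all pairs — verbatim the tree template
`BoundedL2ClassicalMild.mild_of_bounded_of_eLpNorm_two_le_of_lt` with `2 ↦ 6` and the classical
input replaced by the bounded weak form. -/
theorem stub_oseenMildOfL6 :
    ∀ v : ℝ → EuclideanSpace ℝ (Fin 3) → EuclideanSpace ℝ (Fin 3),
      Literature.Analysis.FluidPDE.IsBoundedAncientMildSolution 1 v →
      ContinuousOn (Function.uncurry v) (Set.Iio 0 ×ˢ Set.univ) →
      (∃ K : NNReal, ∀ s < 0, MeasureTheory.eLpNorm (v s) 6 MeasureTheory.volume ≤ K) →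
      ∀ s t : ℝ, s < t → t < 0 → ∀ x,
        v t x = Literature.Analysis.UnboundedOperators.heatExtension (v s) (t - s) x -
          Literature.Analysis.FluidPDE.oseenDuhamel 1 s v v t x :=
  Theorems.ParabolicGaldiLiouville.Birth.stub_oseenMildOfL6

/-- **The sharp stub of reshaping 2 implies stub T** (it is the first gate), so the reshaped
line subsumes the previous one. -/
theorem twoGate_of_sqIntegrableEnstrophy
    (h : ∀ v : ℝ → EuclideanSpace ℝ (Fin 3) → EuclideanSpace ℝ (Fin 3),
      Literature.Analysis.FluidPDE.IsBoundedAncientMildSolution 1 v →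
      ContDiffOn ℝ (⊤ : ℕ∞) (Function.uncurry v) (Set.Iio 0 ×ˢ Set.univ) →
      (∃ C : NNReal, ∀ s < 0, ∫⁻ y, ENNReal.ofReal
          (Literature.Analysis.FluidPDE.frobeniusNormSq (fderiv ℝ (v s) y)) ≤ C) →
      (∀ s < 0, MeasureTheory.MemLp (v s) 6 MeasureTheory.volume) →
      (∫⁻ s in Set.Iio 0, (∫⁻ y, ENNReal.ofReal
          (Literature.Analysis.FluidPDE.frobeniusNormSq (fderiv ℝ (v s) y))) ^ 2) < ⊤) :
    ∀ v : ℝ → EuclideanSpace ℝ (Fin 3) → EuclideanSpace ℝ (Fin 3),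
      Literature.Analysis.FluidPDE.IsBoundedAncientMildSolution 1 v →
      ContDiffOn ℝ (⊤ : ℕ∞) (Function.uncurry v) (Set.Iio 0 ×ˢ Set.univ) →
      (∃ C : NNReal, ∀ s < 0, ∫⁻ y, ENNReal.ofReal
          (Literature.Analysis.FluidPDE.frobeniusNormSq (fderiv ℝ (v s) y)) ≤ C) →
      (∀ s < 0, MeasureTheory.MemLp (v s) 6 MeasureTheory.volume) →
      (∫⁻ s in Set.Iio 0, (∫⁻ y, ENNReal.ofReal
          (Literature.Analysis.FluidPDE.frobeniusNormSq (fderiv ℝ (v s) y))) ^ 2) < ⊤ ∨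
      (∃ (τ : ℕ → ℝ) (M : ENNReal), M < ⊤ ∧ Filter.Tendsto τ Filter.atTop Filter.atBot ∧
        (∀ k, τ k < 0) ∧ ∀ k, MeasureTheory.eLpNorm (v (τ k)) 3 MeasureTheory.volume ≤ M) :=
  fun v hv hsm hens hL6 => Or.inl (h v hv hsm hens hL6)

/-- **The crux implies stub T** (so the crux is EQUIVALENT to the two-gate property in its own
class, given `stub_oseenMildOfL6` and the two proved Liouville theorems): `v ≡ 0` has zero
enstrophy history (and zero `L³` norms). -/
theorem twoGate_of_crux (hX2 : Theses.GaldiLiouvilleGate.ParabolicGaldiLiouville) :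
    ∀ v : ℝ → EuclideanSpace ℝ (Fin 3) → EuclideanSpace ℝ (Fin 3),
      Literature.Analysis.FluidPDE.IsBoundedAncientMildSolution 1 v →
      ContDiffOn ℝ (⊤ : ℕ∞) (Function.uncurry v) (Set.Iio 0 ×ˢ Set.univ) →
      (∃ C : NNReal, ∀ s < 0, ∫⁻ y, ENNReal.ofReal
          (Literature.Analysis.FluidPDE.frobeniusNormSq (fderiv ℝ (v s) y)) ≤ C) →
      (∀ s < 0, MeasureTheory.MemLp (v s) 6 MeasureTheory.volume) →
      (∫⁻ s in Set.Iio 0, (∫⁻ y, ENNReal.ofReal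
          (Literature.Analysis.FluidPDE.frobeniusNormSq (fderiv ℝ (v s) y))) ^ 2) < ⊤ ∨
      (∃ (τ : ℕ → ℝ) (M : ENNReal), M < ⊤ ∧ Filter.Tendsto τ Filter.atTop Filter.atBot ∧
        (∀ k, τ k < 0) ∧ ∀ k, MeasureTheory.eLpNorm (v (τ k)) 3 MeasureTheory.volume ≤ M) := by
  intro v hv hsm hens hL6
  refine Or.inl ?_
  have hzero : ∀ s < (0 : ℝ), v s = fun _ => 0 := fun s hs => funext (hX2 v hv hsm hens hL6 s hs)
  have hint : ∀ s ∈ Iio (0 : ℝ),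
      (∫⁻ y, ENNReal.ofReal (frobeniusNormSq (fderiv ℝ (v s) y))) ^ 2 = 0 := fun s hs => by
    simp [hzero s hs, frobeniusNormSq_zero]
  rw [setLIntegral_congr_fun measurableSet_Iio hint, lintegral_zero]
  exact ENNReal.zero_lt_top

/-- **The birth stub 1 implies stub 1′**: under the uniform bound `E(s) ≤ C`,
`E(s)² ≤ C · E(s)`, so finite total dissipation gives a square-integrable enstrophy history.
(Hence the birth line is subsumed by the reshaped one.) -/
theorem sqIntegrableEnstrophy_of_finiteDissipation
    {v : ℝ → EuclideanSpace ℝ (Fin 3) → EuclideanSpace ℝ (Fin 3)}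
    (hens : ∃ C : NNReal, ∀ s < 0, ∫⁻ y, ENNReal.ofReal
          (Literature.Analysis.FluidPDE.frobeniusNormSq (fderiv ℝ (v s) y)) ≤ C)
    (hdiss : (∫⁻ s in Set.Iio 0, ∫⁻ y, ENNReal.ofReal
          (Literature.Analysis.FluidPDE.frobeniusNormSq (fderiv ℝ (v s) y))) < ⊤) :
    (∫⁻ s in Set.Iio 0, (∫⁻ y, ENNReal.ofReal
          (Literature.Analysis.FluidPDE.frobeniusNormSq (fderiv ℝ (v s) y))) ^ 2) < ⊤ := by
  obtain ⟨C, hC⟩ := hens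
  have hle : ∀ s ∈ Iio (0 : ℝ),
      (∫⁻ y, ENNReal.ofReal (frobeniusNormSq (fderiv ℝ (v s) y))) ^ 2 ≤
        (C : ℝ≥0∞) * ∫⁻ y, ENNReal.ofReal (frobeniusNormSq (fderiv ℝ (v s) y)) := fun s hs => by
    rw [pow_two]
    gcongr
    exact hC s hs
  calc (∫⁻ s in Set.Iio 0, (∫⁻ y, ENNReal.ofReal (frobeniusNormSq (fderiv ℝ (v s) y))) ^ 2)
      ≤ ∫⁻ s in Set.Iio 0, (C : ℝ≥0∞) * ∫⁻ y, ENNReal.ofReal (frobeniusNormSq (fderiv ℝ (v s) y)) :=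
        setLIntegral_mono' measurableSet_Iio hle
    _ = (C : ℝ≥0∞) * ∫⁻ s in Set.Iio 0, ∫⁻ y, ENNReal.ofReal (frobeniusNormSq (fderiv ℝ (v s) y)) :=
        lintegral_const_mul' _ _ ENNReal.coe_ne_top
    _ < ⊤ := ENNReal.mul_lt_top ENNReal.coe_lt_top hdiss

/-- **The crux implies stub 1′** (so, given the glue below and Seregin's theorem, the crux is
EQUIVALENT to square-integrability of the enstrophy history in its own class): if `v ≡ 0` on
`(−∞,0) × ℝ³` then `∇v ≡ 0` and the integrand vanishes. -/
theorem sqIntegrableEnstrophy_of_crux (hX2 : Theses.GaldiLiouvilleGate.ParabolicGaldiLiouville) :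
    ∀ v : ℝ → EuclideanSpace ℝ (Fin 3) → EuclideanSpace ℝ (Fin 3),
      Literature.Analysis.FluidPDE.IsBoundedAncientMildSolution 1 v →
      ContDiffOn ℝ (⊤ : ℕ∞) (Function.uncurry v) (Set.Iio 0 ×ˢ Set.univ) →
      (∃ C : NNReal, ∀ s < 0, ∫⁻ y, ENNReal.ofReal
          (Literature.Analysis.FluidPDE.frobeniusNormSq (fderiv ℝ (v s) y)) ≤ C) →
      (∀ s < 0, MeasureTheory.MemLp (v s) 6 MeasureTheory.volume) →
      (∫⁻ s in Set.Iio 0, (∫⁻ y, ENNReal.ofReal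
          (Literature.Analysis.FluidPDE.frobeniusNormSq (fderiv ℝ (v s) y))) ^ 2) < ⊤ := by
  intro v hv hsm hens hL6
  have hzero : ∀ s < (0 : ℝ), v s = fun _ => 0 := fun s hs => funext (hX2 v hv hsm hens hL6 s hs)
  have hint : ∀ s ∈ Iio (0 : ℝ),
      (∫⁻ y, ENNReal.ofReal (frobeniusNormSq (fderiv ℝ (v s) y))) ^ 2 = 0 := fun s hs => by
    simp [hzero s hs, frobeniusNormSq_zero]
  rw [setLIntegral_congr_fun measurableSet_Iio hint, lintegral_zero]
  exact ENNReal.zero_lt_top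

/-- **stub 2b′ — `lpsSixFourOfSobolev` — LANDED** (p152008,
`Theorems/GaldiLiouvilleGateParabolicGaldiLiouvilleStubLpsSixFourOfSobolev.lean`; the bookkeeping
of the sharp gate). GIVEN the slice-wise Sobolev inequality of stub 2a (explicit hypothesis), a
field smooth on `(−∞,0) × ℝ³` with `L⁶` slices and square-integrable enstrophy history has a
finite Ladyzhenskaya–Prodi–Serrin quantity at `(s, l) = (6, 4)`: `∫_{t<0} ‖v(t)‖_{L⁶}⁴ dt < ∞`
(`‖v(t)‖₆⁴ ≤ K⁴ (∫|∇v(t)|_F²)²` for every `t < 0`). Boundedness of `v` is not needed. -/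
theorem lpsSixFourOfSobolev :
    (∃ K : NNReal, ∀ u : EuclideanSpace ℝ (Fin 3) → EuclideanSpace ℝ (Fin 3),
      ContDiff ℝ 1 u → MeasureTheory.MemLp u 6 MeasureTheory.volume →
      MeasureTheory.eLpNorm u 6 MeasureTheory.volume ≤
        (K : ENNReal) * (∫⁻ y, ENNReal.ofReal
          (Literature.Analysis.FluidPDE.frobeniusNormSq (fderiv ℝ u y))) ^ (1 / 2 : ℝ)) →
    ∀ v : ℝ → EuclideanSpace ℝ (Fin 3) → EuclideanSpace ℝ (Fin 3),
      ContDiffOn ℝ (⊤ : ℕ∞) (Function.uncurry v) (Set.Iio 0 ×ˢ Set.univ) →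
      (∀ s < 0, MeasureTheory.MemLp (v s) 6 MeasureTheory.volume) →
      (∫⁻ s in Set.Iio 0, (∫⁻ y, ENNReal.ofReal
          (Literature.Analysis.FluidPDE.frobeniusNormSq (fderiv ℝ (v s) y))) ^ 2) < ⊤ →
      (∫⁻ t in Set.Iio 0,
          (MeasureTheory.eLpNorm (v t) (ENNReal.ofReal 6) MeasureTheory.volume) ^ (4 : ℝ)) < ⊤ :=
  Theorems.ParabolicGaldiLiouville.Birth.stub_lpsSixFourOfSobolev

/-- **stub 2a — `sobolevSixFrobenius` — LANDED** (p148385,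
`Theorems/GaldiLiouvilleGateParabolicGaldiLiouvilleStubSobolevSixFrobenius.lean`, wave 1 of lead
c1). The Gagliardo–Nirenberg–Sobolev inequality `Ḣ¹ ∩ L⁶ ⊂ L⁶` on `ℝ³` WITHOUT compact support,
in Frobenius form: there is a constant `K` such that every `C¹` field `u : ℝ³ → ℝ³` with `u ∈ L⁶`
satisfies `‖u‖_{L⁶} ≤ K (∫ |∇u|_F²)^{1/2}` (range truncation `(n+1)⁻¹ ψ((n+1)u)`, the tree's
`eLpNorm_le_eLpNorm_fderiv_of_eq_of_eLpNorm_lt_top`, Fatou). -/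
theorem sobolevSixFrobenius :
    ∃ K : NNReal, ∀ u : EuclideanSpace ℝ (Fin 3) → EuclideanSpace ℝ (Fin 3),
      ContDiff ℝ 1 u → MeasureTheory.MemLp u 6 MeasureTheory.volume →
      MeasureTheory.eLpNorm u 6 MeasureTheory.volume ≤
        (K : ENNReal) * (∫⁻ y, ENNReal.ofReal
          (Literature.Analysis.FluidPDE.frobeniusNormSq (fderiv ℝ u y))) ^ (1 / 2 : ℝ) :=
  Theorems.ParabolicGaldiLiouville.Birth.stub_sobolevSixFrobenius

/-- **stub 2b — `lpsOfSobolev` — LANDED** (p146741,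
`Theorems/GaldiLiouvilleGateParabolicGaldiLiouvilleStubLpsOfSobolev.lean`, wave 1 of lead c1).
GIVEN the slice-wise Sobolev inequality of stub 2a (as an explicit hypothesis), a field bounded on
`(−∞,0) × ℝ³`, smooth there, with `L⁶` slices and finite total dissipation has a finite
Ladyzhenskaya–Prodi–Serrin quantity at `(s, l) = (9, 3)`: `∫_{t<0} ‖v(t)‖_{L⁹}³ dt < ∞`
(`‖v(t)‖₉³ ≤ ‖v‖_∞ ‖v(t)‖₆² ≤ ‖v‖_∞ K² ∫|∇v(t)|_F²` pointwise in `t`, monotone time integral). -/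
theorem lpsOfSobolev :
    (∃ K : NNReal, ∀ u : EuclideanSpace ℝ (Fin 3) → EuclideanSpace ℝ (Fin 3),
      ContDiff ℝ 1 u → MeasureTheory.MemLp u 6 MeasureTheory.volume →
      MeasureTheory.eLpNorm u 6 MeasureTheory.volume ≤
        (K : ENNReal) * (∫⁻ y, ENNReal.ofReal
          (Literature.Analysis.FluidPDE.frobeniusNormSq (fderiv ℝ u y))) ^ (1 / 2 : ℝ)) →
    ∀ v : ℝ → EuclideanSpace ℝ (Fin 3) → EuclideanSpace ℝ (Fin 3),
      Literature.Analysis.FluidPDE.IsBoundedOn (Set.Iio 0) v →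
      ContDiffOn ℝ (⊤ : ℕ∞) (Function.uncurry v) (Set.Iio 0 ×ˢ Set.univ) →
      (∀ s < 0, MeasureTheory.MemLp (v s) 6 MeasureTheory.volume) →
      (∫⁻ s in Set.Iio 0, ∫⁻ y, ENNReal.ofReal
          (Literature.Analysis.FluidPDE.frobeniusNormSq (fderiv ℝ (v s) y))) < ⊤ →
      (∫⁻ t in Set.Iio 0,
          (MeasureTheory.eLpNorm (v t) (ENNReal.ofReal 9) MeasureTheory.volume) ^ (3 : ℝ)) < ⊤ :=
  Theorems.ParabolicGaldiLiouville.Birth.stub_lpsOfSobolev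

/-- **Birth stub 2 (`lpsOfFiniteDissipation`), now a THEOREM: the landed 2b applied to the landed
2a** (same statement as the birth stub, so the composition `parabolicGaldiLiouville_of_hyps` is
untouched). -/
theorem lpsOfFiniteDissipation :
    ∀ v : ℝ → EuclideanSpace ℝ (Fin 3) → EuclideanSpace ℝ (Fin 3),
      Literature.Analysis.FluidPDE.IsBoundedOn (Set.Iio 0) v →
      ContDiffOn ℝ (⊤ : ℕ∞) (Function.uncurry v) (Set.Iio 0 ×ˢ Set.univ) →
      (∀ s < 0, MeasureTheory.MemLp (v s) 6 MeasureTheory.volume) →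
      (∫⁻ s in Set.Iio 0, ∫⁻ y, ENNReal.ofReal
          (Literature.Analysis.FluidPDE.frobeniusNormSq (fderiv ℝ (v s) y))) < ⊤ →
      (∫⁻ t in Set.Iio 0,
          (MeasureTheory.eLpNorm (v t) (ENNReal.ofReal 9) MeasureTheory.volume) ^ (3 : ℝ)) < ⊤ :=
  lpsOfSobolev sobolevSixFrobenius

/-! ### Glue (proved): continuity upgrades, and the composition through Seregin's theorem -/

/-- Slices of a field continuous on `(−∞,0) × ℝ³` are continuous. -/
theorem continuous_slice {v : ℝ → EuclideanSpace ℝ (Fin 3) → EuclideanSpace ℝ (Fin 3)}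
    (hc : ContinuousOn (uncurry v) (Iio 0 ×ˢ univ)) {t : ℝ} (ht : t < 0) : Continuous (v t) := by
  have h : Continuous (uncurry v ∘ fun y : EuclideanSpace ℝ (Fin 3) => (t, y)) :=
    hc.comp_continuous (continuous_const.prodMk continuous_id) fun y => ⟨ht, mem_univ y⟩
  exact h

/-- **a.e. ⇒ everywhere.** If `v` is continuous on `(−∞,0) × ℝ³` and `v(t,·) = 0` a.e. in space
for a.e. `t < 0`, then `v s y = 0` for every `s < 0` and every `y`: a continuous slice equals its
a.e. class (`Continuous.ae_eq_iff_eq`), and a non-zero value `v s y ≠ 0` would persist for `t` in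
a neighbourhood of `s`, a set of positive Lebesgue measure. -/
theorem eq_zero_of_ae_of_continuousOn
    {v : ℝ → EuclideanSpace ℝ (Fin 3) → EuclideanSpace ℝ (Fin 3)}
    (hc : ContinuousOn (uncurry v) (Iio 0 ×ˢ univ))
    (hae : ∀ᵐ t ∂((volume : Measure ℝ).restrict (Iio 0)),
      v t =ᵐ[(volume : Measure (EuclideanSpace ℝ (Fin 3)))] 0) :
    ∀ s < 0, ∀ y, v s y = 0 := by
  -- (1) for a.e. `t < 0` the continuous slice vanishes identically
  have h1 : ∀ᵐ t ∂(volume : Measure ℝ), t ∈ Iio (0 : ℝ) → v t = 0 := by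
    refine (ae_restrict_iff' measurableSet_Iio).1 ?_
    filter_upwards [hae, ae_restrict_mem measurableSet_Iio] with t ht htI
    exact (Continuous.ae_eq_iff_eq volume (continuous_slice hc htI) continuous_const).1 ht
  -- (2) continuity in time upgrades "a.e. `t`" to "every `t`"
  intro s hs y
  by_contra hne
  have hca : ContinuousAt (fun t => v t y) s := by
    have h' : ContinuousAt (uncurry v) (s, y) :=
      hc.continuousAt ((isOpen_Iio.prod isOpen_univ).mem_nhds ⟨hs, mem_univ _⟩)
    have hg : ContinuousAt (fun t : ℝ => (t, y)) s :=
      (continuous_id.prodMk continuous_const).continuousAt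
    exact ContinuousAt.comp (g := uncurry v) (f := fun t : ℝ => (t, y)) h' hg
  have hA : {t : ℝ | v t y ≠ 0 ∧ t < 0} ∈ 𝓝 s :=
    (hca.eventually_ne hne).and (Iio_mem_nhds hs)
  have hpos : 0 < volume {t : ℝ | v t y ≠ 0 ∧ t < 0} := measure_pos_of_mem_nhds volume hA
  have hnull : volume {t : ℝ | v t y ≠ 0 ∧ t < 0} = 0 := by
    refine measure_mono_null (fun t ht => ?_) (ae_iff.1 h1)
    simp only [mem_setOf_eq] at ht ⊢
    intro himp
    exact ht.1 (by simpa using congrFun (himp ht.2) y)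
  exact hpos.ne' hnull

/-- **The composition with the two stub STATEMENTS as hypotheses (closed: no placeholder).**
Stub 1 gives finite total dissipation, stub 2 the finite LPS quantity at `(9, 3)`; the tree's
proved Seregin Liouville theorem (`Seregin2014_ancient_liouville_LPS_holds`, Lecture Notes 2014
Thm 4.12), transferred to the duality-form mild class, gives a.e. vanishing, and
`eq_zero_of_ae_of_continuousOn` upgrades it to pointwise vanishing. -/
theorem parabolicGaldiLiouville_of_hyps
    (h1 : ∀ v : ℝ → EuclideanSpace ℝ (Fin 3) → EuclideanSpace ℝ (Fin 3),
      Literature.Analysis.FluidPDE.IsBoundedAncientMildSolution 1 v →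
      ContDiffOn ℝ (⊤ : ℕ∞) (Function.uncurry v) (Set.Iio 0 ×ˢ Set.univ) →
      (∃ C : NNReal, ∀ s < 0, ∫⁻ y, ENNReal.ofReal
          (Literature.Analysis.FluidPDE.frobeniusNormSq (fderiv ℝ (v s) y)) ≤ C) →
      (∀ s < 0, MeasureTheory.MemLp (v s) 6 MeasureTheory.volume) →
      (∫⁻ s in Set.Iio 0, ∫⁻ y, ENNReal.ofReal
          (Literature.Analysis.FluidPDE.frobeniusNormSq (fderiv ℝ (v s) y))) < ⊤)
    (h2 : ∀ v : ℝ → EuclideanSpace ℝ (Fin 3) → EuclideanSpace ℝ (Fin 3),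
      Literature.Analysis.FluidPDE.IsBoundedOn (Set.Iio 0) v →
      ContDiffOn ℝ (⊤ : ℕ∞) (Function.uncurry v) (Set.Iio 0 ×ˢ Set.univ) →
      (∀ s < 0, MeasureTheory.MemLp (v s) 6 MeasureTheory.volume) →
      (∫⁻ s in Set.Iio 0, ∫⁻ y, ENNReal.ofReal
          (Literature.Analysis.FluidPDE.frobeniusNormSq (fderiv ℝ (v s) y))) < ⊤ →
      (∫⁻ t in Set.Iio 0,
          (MeasureTheory.eLpNorm (v t) (ENNReal.ofReal 9) MeasureTheory.volume) ^ (3 : ℝ)) < ⊤) :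
    ∀ v : ℝ → EuclideanSpace ℝ (Fin 3) → EuclideanSpace ℝ (Fin 3),
      Literature.Analysis.FluidPDE.IsBoundedAncientMildSolution 1 v →
      ContDiffOn ℝ (⊤ : ℕ∞) (Function.uncurry v) (Set.Iio 0 ×ˢ Set.univ) →
      (∃ C : NNReal, ∀ s < 0, ∫⁻ y, ENNReal.ofReal
          (Literature.Analysis.FluidPDE.frobeniusNormSq (fderiv ℝ (v s) y)) ≤ C) →
      (∀ s < 0, MeasureTheory.MemLp (v s) 6 MeasureTheory.volume) →
      ∀ s < 0, ∀ y, v s y = 0 := by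
  intro v hv hsm hens hL6
  -- the two stubs: finite total dissipation, then the finite LPS quantity at (9, 3)
  have hdiss := h1 v hv hsm hens hL6
  have hlps := h2 v hv.isBoundedOn hsm hL6 hdiss
  -- measurability bookkeeping from smoothness
  have hc : ContinuousOn (uncurry v) (Iio 0 ×ˢ univ) := hsm.continuousOn
  have hmeas : AEStronglyMeasurable (uncurry v)
      ((volume : Measure (ℝ × EuclideanSpace ℝ (Fin 3))).restrict (Iio 0 ×ˢ univ)) :=
    hc.aestronglyMeasurable (measurableSet_Iio.prod MeasurableSet.univ)
  have hsl : ∀ t < 0, AEStronglyMeasurable (v t) volume := fun t ht =>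
    (continuous_slice hc ht).aestronglyMeasurable
  -- Seregin 2014 Thm 4.12 (proved in the tree), in the duality-form mild class
  have hae : ∀ᵐ t ∂((volume : Measure ℝ).restrict (Iio 0)),
      v t =ᵐ[(volume : Measure (EuclideanSpace ℝ (Fin 3)))] 0 :=
    Seregin2014_ancient_liouville_LPS_holds.of_isBoundedAncientMildSolution hv hmeas hsl
      (s := 9) (l := 3) (by norm_num) (by norm_num) hlps
  -- a.e. ⇒ everywhere by continuity
  exact eq_zero_of_ae_of_continuousOn hc hae

/-- **The composition of the SHARP gate, with the stub STATEMENTS as hypotheses (closed).**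
Stub 1′ gives a square-integrable enstrophy history, stub 2b′ (with 2a) the finite LPS quantity at
`(6, 4)`; Seregin's theorem (`(s, l) = (6, 4)`, `3/6 + 2/4 = 1`) gives a.e. vanishing and
`eq_zero_of_ae_of_continuousOn` upgrades it to pointwise vanishing. -/
theorem parabolicGaldiLiouville_of_hyps_sq
    (h1 : ∀ v : ℝ → EuclideanSpace ℝ (Fin 3) → EuclideanSpace ℝ (Fin 3),
      Literature.Analysis.FluidPDE.IsBoundedAncientMildSolution 1 v →
      ContDiffOn ℝ (⊤ : ℕ∞) (Function.uncurry v) (Set.Iio 0 ×ˢ Set.univ) →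
      (∃ C : NNReal, ∀ s < 0, ∫⁻ y, ENNReal.ofReal
          (Literature.Analysis.FluidPDE.frobeniusNormSq (fderiv ℝ (v s) y)) ≤ C) →
      (∀ s < 0, MeasureTheory.MemLp (v s) 6 MeasureTheory.volume) →
      (∫⁻ s in Set.Iio 0, (∫⁻ y, ENNReal.ofReal
          (Literature.Analysis.FluidPDE.frobeniusNormSq (fderiv ℝ (v s) y))) ^ 2) < ⊤)
    (h2 : ∀ v : ℝ → EuclideanSpace ℝ (Fin 3) → EuclideanSpace ℝ (Fin 3),
      ContDiffOn ℝ (⊤ : ℕ∞) (Function.uncurry v) (Set.Iio 0 ×ˢ Set.univ) →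
      (∀ s < 0, MeasureTheory.MemLp (v s) 6 MeasureTheory.volume) →
      (∫⁻ s in Set.Iio 0, (∫⁻ y, ENNReal.ofReal
          (Literature.Analysis.FluidPDE.frobeniusNormSq (fderiv ℝ (v s) y))) ^ 2) < ⊤ →
      (∫⁻ t in Set.Iio 0,
          (MeasureTheory.eLpNorm (v t) (ENNReal.ofReal 6) MeasureTheory.volume) ^ (4 : ℝ)) < ⊤) :
    ∀ v : ℝ → EuclideanSpace ℝ (Fin 3) → EuclideanSpace ℝ (Fin 3),
      Literature.Analysis.FluidPDE.IsBoundedAncientMildSolution 1 v →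
      ContDiffOn ℝ (⊤ : ℕ∞) (Function.uncurry v) (Set.Iio 0 ×ˢ Set.univ) →
      (∃ C : NNReal, ∀ s < 0, ∫⁻ y, ENNReal.ofReal
          (Literature.Analysis.FluidPDE.frobeniusNormSq (fderiv ℝ (v s) y)) ≤ C) →
      (∀ s < 0, MeasureTheory.MemLp (v s) 6 MeasureTheory.volume) →
      ∀ s < 0, ∀ y, v s y = 0 := by
  intro v hv hsm hens hL6
  have hsq := h1 v hv hsm hens hL6
  have hlps := h2 v hsm hL6 hsq
  have hc : ContinuousOn (uncurry v) (Iio 0 ×ˢ univ) := hsm.continuousOn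
  have hmeas : AEStronglyMeasurable (uncurry v)
      ((volume : Measure (ℝ × EuclideanSpace ℝ (Fin 3))).restrict (Iio 0 ×ˢ univ)) :=
    hc.aestronglyMeasurable (measurableSet_Iio.prod MeasurableSet.univ)
  have hsl : ∀ t < 0, AEStronglyMeasurable (v t) volume := fun t ht =>
    (continuous_slice hc ht).aestronglyMeasurable
  have hae : ∀ᵐ t ∂((volume : Measure ℝ).restrict (Iio 0)),
      v t =ᵐ[(volume : Measure (EuclideanSpace ℝ (Fin 3)))] 0 :=
    Seregin2014_ancient_liouville_LPS_holds.of_isBoundedAncientMildSolution hv hmeas hsl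
      (s := 6) (l := 4) (by norm_num) (by norm_num) hlps
  exact eq_zero_of_ae_of_continuousOn hc hae

/-! ### Reshaping 3 (lead c2): the two-gate composition -/

/-- **Uniform `L⁶` bound in the class** (glue, proved): GIVEN the slice-wise Sobolev inequality
of stub 2a (explicit hypothesis), a field smooth on `(−∞,0) × ℝ³` with `L⁶` slices and enstrophy
bounded by `C` has `‖v(s)‖_{L⁶} ≤ K C^{1/2}` for every `s < 0`. -/
theorem eLpNorm_six_le_of_enstrophy
    (hSob : ∃ K : NNReal, ∀ u : EuclideanSpace ℝ (Fin 3) → EuclideanSpace ℝ (Fin 3),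
      ContDiff ℝ 1 u → MeasureTheory.MemLp u 6 MeasureTheory.volume →
      MeasureTheory.eLpNorm u 6 MeasureTheory.volume ≤
        (K : ENNReal) * (∫⁻ y, ENNReal.ofReal
          (Literature.Analysis.FluidPDE.frobeniusNormSq (fderiv ℝ u y))) ^ (1 / 2 : ℝ))
    {v : ℝ → EuclideanSpace ℝ (Fin 3) → EuclideanSpace ℝ (Fin 3)}
    (hsm : ContDiffOn ℝ (⊤ : ℕ∞) (Function.uncurry v) (Set.Iio 0 ×ˢ Set.univ))
    (hens : ∃ C : NNReal, ∀ s < 0, ∫⁻ y, ENNReal.ofReal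
          (Literature.Analysis.FluidPDE.frobeniusNormSq (fderiv ℝ (v s) y)) ≤ C)
    (hL6 : ∀ s < 0, MeasureTheory.MemLp (v s) 6 MeasureTheory.volume) :
    ∃ K' : NNReal, ∀ s < 0, MeasureTheory.eLpNorm (v s) 6 MeasureTheory.volume ≤ K' := by
  obtain ⟨K, hK⟩ := hSob
  obtain ⟨C, hC⟩ := hens
  have hfin : (K : ℝ≥0∞) * (C : ℝ≥0∞) ^ (1 / 2 : ℝ) ≠ ⊤ :=
    ENNReal.mul_ne_top ENNReal.coe_ne_top
      (ENNReal.rpow_ne_top_of_nonneg (by norm_num) ENNReal.coe_ne_top)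
  refine ⟨((K : ℝ≥0∞) * (C : ℝ≥0∞) ^ (1 / 2 : ℝ)).toNNReal, fun s hs => ?_⟩
  rw [ENNReal.coe_toNNReal hfin]
  calc eLpNorm (v s) 6 volume
      ≤ (K : ℝ≥0∞) * (∫⁻ y, ENNReal.ofReal (frobeniusNormSq (fderiv ℝ (v s) y))) ^ (1 / 2 : ℝ) :=
        hK (v s) (Theorems.ParabolicGaldiLiouville.Birth.LpsOfSobolev.contDiff_slice hsm hs) (hL6 s hs)
    _ ≤ (K : ℝ≥0∞) * (C : ℝ≥0∞) ^ (1 / 2 : ℝ) :=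
        mul_le_mul' le_rfl (ENNReal.rpow_le_rpow (hC s hs) (by norm_num))

/-- **The composition of the TWO-GATE skeleton, with the stub STATEMENTS as hypotheses
(closed).** For `v` in the class, stub T gives one of the two gates. Gate 1 (`∫E² < ∞`): the
landed sharp chain (2a, 2b′, Seregin 2014 Thm 4.12, continuity upgrade;
`DecayRung.eq_zero_of_sqIntegrableEnstrophy`, p153466). Gate 2 (bounded `L³` norms along a
backward sequence): the class has uniformly-`L⁶` slices (`eLpNorm_six_le_of_enstrophy` with 2a),
so stub O puts `v` in the Oseen integral-equation class, where the tree's proved Albritton–Barker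
2019 Thm 1.2 (`AlbrittonBarker2019_liouville_L3_backward_holds`) gives `v t x = 0` for all
`t < 0`, `x`. -/
theorem parabolicGaldiLiouville_of_hyps_twoGate
    (hT : ∀ v : ℝ → EuclideanSpace ℝ (Fin 3) → EuclideanSpace ℝ (Fin 3),
      Literature.Analysis.FluidPDE.IsBoundedAncientMildSolution 1 v →
      ContDiffOn ℝ (⊤ : ℕ∞) (Function.uncurry v) (Set.Iio 0 ×ˢ Set.univ) →
      (∃ C : NNReal, ∀ s < 0, ∫⁻ y, ENNReal.ofReal
          (Literature.Analysis.FluidPDE.frobeniusNormSq (fderiv ℝ (v s) y)) ≤ C) →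
      (∀ s < 0, MeasureTheory.MemLp (v s) 6 MeasureTheory.volume) →
      (∫⁻ s in Set.Iio 0, (∫⁻ y, ENNReal.ofReal
          (Literature.Analysis.FluidPDE.frobeniusNormSq (fderiv ℝ (v s) y))) ^ 2) < ⊤ ∨
      (∃ (τ : ℕ → ℝ) (M : ENNReal), M < ⊤ ∧ Filter.Tendsto τ Filter.atTop Filter.atBot ∧
        (∀ k, τ k < 0) ∧ ∀ k, MeasureTheory.eLpNorm (v (τ k)) 3 MeasureTheory.volume ≤ M))
    (hO : ∀ v : ℝ → EuclideanSpace ℝ (Fin 3) → EuclideanSpace ℝ (Fin 3),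
      Literature.Analysis.FluidPDE.IsBoundedAncientMildSolution 1 v →
      ContinuousOn (Function.uncurry v) (Set.Iio 0 ×ˢ Set.univ) →
      (∃ K : NNReal, ∀ s < 0, MeasureTheory.eLpNorm (v s) 6 MeasureTheory.volume ≤ K) →
      ∀ s t : ℝ, s < t → t < 0 → ∀ x,
        v t x = Literature.Analysis.UnboundedOperators.heatExtension (v s) (t - s) x -
          Literature.Analysis.FluidPDE.oseenDuhamel 1 s v v t x)
    (hSob : ∃ K : NNReal, ∀ u : EuclideanSpace ℝ (Fin 3) → EuclideanSpace ℝ (Fin 3),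
      ContDiff ℝ 1 u → MeasureTheory.MemLp u 6 MeasureTheory.volume →
      MeasureTheory.eLpNorm u 6 MeasureTheory.volume ≤
        (K : ENNReal) * (∫⁻ y, ENNReal.ofReal
          (Literature.Analysis.FluidPDE.frobeniusNormSq (fderiv ℝ u y))) ^ (1 / 2 : ℝ)) :
    ∀ v : ℝ → EuclideanSpace ℝ (Fin 3) → EuclideanSpace ℝ (Fin 3),
      Literature.Analysis.FluidPDE.IsBoundedAncientMildSolution 1 v →
      ContDiffOn ℝ (⊤ : ℕ∞) (Function.uncurry v) (Set.Iio 0 ×ˢ Set.univ) →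
      (∃ C : NNReal, ∀ s < 0, ∫⁻ y, ENNReal.ofReal
          (Literature.Analysis.FluidPDE.frobeniusNormSq (fderiv ℝ (v s) y)) ≤ C) →
      (∀ s < 0, MeasureTheory.MemLp (v s) 6 MeasureTheory.volume) →
      ∀ s < 0, ∀ y, v s y = 0 := by
  intro v hv hsm hens hL6
  rcases hT v hv hsm hens hL6 with hsq | ⟨τ, M, hMtop, hτ, hτ0, hτM⟩
  · -- gate 1: square-integrable enstrophy history
    exact Theorems.ParabolicGaldiLiouville.Birth.DecayRung.eq_zero_of_sqIntegrableEnstrophy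
      hv hsm hL6 hsq
  · -- gate 2: bounded `L³` norms along a backward sequence of times
    have h6 := eLpNorm_six_le_of_enstrophy hSob hsm hens hL6
    have hoseen := hO v hv hsm.continuousOn h6
    intro s hs y
    exact AlbrittonBarker2019_liouville_L3_backward_holds hsm.continuousOn hv.2
      (fun t ht => hv.1.1 t ht) hoseen ⟨τ, M, hMtop, hτ, hτ0, hτM⟩ s hs y

/-! ### Reshaping 4 (lead c2): the SHARP two-gate composition (gate A = self-similar liminf) -/

/-- **Gate 1 of reshaping 3 implies gate A** (selection of good early times): a field smooth on
`(−∞,0) × ℝ³` with `L⁶` slices and square-integrable enstrophy history has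
`∫_{t<0} ‖v(t)‖₆⁴ dt < ∞` (landed 2b′ with 2a), so for every `ε > 0`, `R > 0` the set of times
`σ < −R` with `‖v(σ)‖₆⁴ |σ| < ε` has positive measure
(`measure_pos_setOf_mul_lt_of_lintegral_Iio_ne_top`), in particular is nonempty. -/
theorem gateA_of_sqIntegrableEnstrophy
    {v : ℝ → EuclideanSpace ℝ (Fin 3) → EuclideanSpace ℝ (Fin 3)}
    (hsm : ContDiffOn ℝ (⊤ : ℕ∞) (Function.uncurry v) (Set.Iio 0 ×ˢ Set.univ))
    (hL6 : ∀ s < 0, MeasureTheory.MemLp (v s) 6 MeasureTheory.volume)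
    (hsq : (∫⁻ s in Set.Iio 0, (∫⁻ y, ENNReal.ofReal
          (Literature.Analysis.FluidPDE.frobeniusNormSq (fderiv ℝ (v s) y))) ^ 2) < ⊤) :
    ∀ ε : ENNReal, 0 < ε → ∀ R : ℝ, 0 < R → ∃ σ : ℝ, σ < -R ∧
      MeasureTheory.eLpNorm (v σ) 6 MeasureTheory.volume ^ (4 : ℝ) * ENNReal.ofReal (-σ) < ε := by
  intro ε hε R hR
  have hlps := lpsSixFourOfSobolev sobolevSixFrobenius v hsm hL6 hsq
  have h6 : ENNReal.ofReal 6 = 6 := by norm_num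
  simp only [h6] at hlps
  have hpos := measure_pos_setOf_mul_lt_of_lintegral_Iio_ne_top
    (F := fun σ => eLpNorm (v σ) 6 volume ^ (4 : ℝ)) hlps.ne hR hε
  obtain ⟨σ, hσR, hσε⟩ := nonempty_of_measure_ne_zero hpos.ne'
  exact ⟨σ, hσR, hσε⟩

/-- **The two-gate property of reshaping 3 implies the sharp one of reshaping 4**
(`gateA_of_sqIntegrableEnstrophy` on the first disjunct), so the reshaped line subsumes the
previous one. -/
theorem sharpTwoGate_of_twoGate
    (h : ∀ v : ℝ → EuclideanSpace ℝ (Fin 3) → EuclideanSpace ℝ (Fin 3),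
      Literature.Analysis.FluidPDE.IsBoundedAncientMildSolution 1 v →
      ContDiffOn ℝ (⊤ : ℕ∞) (Function.uncurry v) (Set.Iio 0 ×ˢ Set.univ) →
      (∃ C : NNReal, ∀ s < 0, ∫⁻ y, ENNReal.ofReal
          (Literature.Analysis.FluidPDE.frobeniusNormSq (fderiv ℝ (v s) y)) ≤ C) →
      (∀ s < 0, MeasureTheory.MemLp (v s) 6 MeasureTheory.volume) →
      (∫⁻ s in Set.Iio 0, (∫⁻ y, ENNReal.ofReal
          (Literature.Analysis.FluidPDE.frobeniusNormSq (fderiv ℝ (v s) y))) ^ 2) < ⊤ ∨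
      (∃ (τ : ℕ → ℝ) (M : ENNReal), M < ⊤ ∧ Filter.Tendsto τ Filter.atTop Filter.atBot ∧
        (∀ k, τ k < 0) ∧ ∀ k, MeasureTheory.eLpNorm (v (τ k)) 3 MeasureTheory.volume ≤ M)) :
    ∀ v : ℝ → EuclideanSpace ℝ (Fin 3) → EuclideanSpace ℝ (Fin 3),
      Literature.Analysis.FluidPDE.IsBoundedAncientMildSolution 1 v →
      ContDiffOn ℝ (⊤ : ℕ∞) (Function.uncurry v) (Set.Iio 0 ×ˢ Set.univ) →
      (∃ C : NNReal, ∀ s < 0, ∫⁻ y, ENNReal.ofReal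
          (Literature.Analysis.FluidPDE.frobeniusNormSq (fderiv ℝ (v s) y)) ≤ C) →
      (∀ s < 0, MeasureTheory.MemLp (v s) 6 MeasureTheory.volume) →
      (∀ ε : ENNReal, 0 < ε → ∀ R : ℝ, 0 < R → ∃ σ : ℝ, σ < -R ∧
        MeasureTheory.eLpNorm (v σ) 6 MeasureTheory.volume ^ (4 : ℝ) * ENNReal.ofReal (-σ) < ε) ∨
      (∃ (τ : ℕ → ℝ) (M : ENNReal), M < ⊤ ∧ Filter.Tendsto τ Filter.atTop Filter.atBot ∧
        (∀ k, τ k < 0) ∧ ∀ k, MeasureTheory.eLpNorm (v (τ k)) 3 MeasureTheory.volume ≤ M) := by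
  intro v hv hsm hens hL6
  rcases h v hv hsm hens hL6 with hsq | hB
  · exact Or.inl (gateA_of_sqIntegrableEnstrophy hsm hL6 hsq)
  · exact Or.inr hB

/-- **The crux implies stub T♯** (so, given the landed stubs and the proved Liouville theorems,
the crux is EQUIVALENT to the sharp two-gate property in its own class). -/
theorem sharpTwoGate_of_crux (hX2 : Theses.GaldiLiouvilleGate.ParabolicGaldiLiouville) :
    ∀ v : ℝ → EuclideanSpace ℝ (Fin 3) → EuclideanSpace ℝ (Fin 3),
      Literature.Analysis.FluidPDE.IsBoundedAncientMildSolution 1 v →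
      ContDiffOn ℝ (⊤ : ℕ∞) (Function.uncurry v) (Set.Iio 0 ×ˢ Set.univ) →
      (∃ C : NNReal, ∀ s < 0, ∫⁻ y, ENNReal.ofReal
          (Literature.Analysis.FluidPDE.frobeniusNormSq (fderiv ℝ (v s) y)) ≤ C) →
      (∀ s < 0, MeasureTheory.MemLp (v s) 6 MeasureTheory.volume) →
      (∀ ε : ENNReal, 0 < ε → ∀ R : ℝ, 0 < R → ∃ σ : ℝ, σ < -R ∧
        MeasureTheory.eLpNorm (v σ) 6 MeasureTheory.volume ^ (4 : ℝ) * ENNReal.ofReal (-σ) < ε) ∨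
      (∃ (τ : ℕ → ℝ) (M : ENNReal), M < ⊤ ∧ Filter.Tendsto τ Filter.atTop Filter.atBot ∧
        (∀ k, τ k < 0) ∧ ∀ k, MeasureTheory.eLpNorm (v (τ k)) 3 MeasureTheory.volume ≤ M) :=
  sharpTwoGate_of_twoGate (twoGate_of_crux hX2)

/-- **The composition of the SHARP TWO-GATE skeleton (reshaping 4), with the stub STATEMENTS as
hypotheses (closed).** For `v` in the class, stub T♯ gives one of the two gates.
GATE A: by `stub_l6Stability` (universal `η`) and gate A with `ε = (min η (k+1)⁻¹)⁴`, `R = k+1`,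
there are times `σ_k < −(k+1)` with `‖v(σ_k)‖₆ |σ_k|^{1/4} ≤ η` and `‖v(σ_k)‖₆ ≤ (k+1)⁻¹`
(`mul_rpow_le_of_rpow_mul_lt`), hence `‖v(t)‖₆ ≤ 4 (k+1)⁻¹` for a.e. `t ∈ (σ_k, 0)`; every
`t < 0` lies in `(σ_k, 0)` for all large `k`, so `‖v(t)‖₆ = 0` for a.e. `t < 0`
(`ENNReal.eq_zero_of_le_four_mul_inv_nat_succ`), `v(t,·) = 0` a.e., and continuity upgrades
this to `v s y = 0` everywhere (`eq_zero_of_ae_of_continuousOn`). GATE B: the class has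
uniformly-`L⁶` slices (`eLpNorm_six_le_of_enstrophy` with 2a), stub O puts `v` in the Oseen
class, and Albritton–Barker's Thm 1.2 (`AlbrittonBarker2019_liouville_L3_backward_holds`)
concludes. -/
theorem parabolicGaldiLiouville_of_hyps_sharpTwoGate
    (hT : ∀ v : ℝ → EuclideanSpace ℝ (Fin 3) → EuclideanSpace ℝ (Fin 3),
      Literature.Analysis.FluidPDE.IsBoundedAncientMildSolution 1 v →
      ContDiffOn ℝ (⊤ : ℕ∞) (Function.uncurry v) (Set.Iio 0 ×ˢ Set.univ) →
      (∃ C : NNReal, ∀ s < 0, ∫⁻ y, ENNReal.ofReal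
          (Literature.Analysis.FluidPDE.frobeniusNormSq (fderiv ℝ (v s) y)) ≤ C) →
      (∀ s < 0, MeasureTheory.MemLp (v s) 6 MeasureTheory.volume) →
      (∀ ε : ENNReal, 0 < ε → ∀ R : ℝ, 0 < R → ∃ σ : ℝ, σ < -R ∧
        MeasureTheory.eLpNorm (v σ) 6 MeasureTheory.volume ^ (4 : ℝ) * ENNReal.ofReal (-σ) < ε) ∨
      (∃ (τ : ℕ → ℝ) (M : ENNReal), M < ⊤ ∧ Filter.Tendsto τ Filter.atTop Filter.atBot ∧
        (∀ k, τ k < 0) ∧ ∀ k, MeasureTheory.eLpNorm (v (τ k)) 3 MeasureTheory.volume ≤ M))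
    (hS : ∃ η : ENNReal, 0 < η ∧
      ∀ v : ℝ → EuclideanSpace ℝ (Fin 3) → EuclideanSpace ℝ (Fin 3),
        Literature.Analysis.FluidPDE.IsBoundedAncientMildSolution 1 v →
        ContinuousOn (Function.uncurry v) (Set.Iio 0 ×ˢ Set.univ) →
        (∃ K : NNReal, ∀ s < 0, MeasureTheory.eLpNorm (v s) 6 MeasureTheory.volume ≤ K) →
        ∀ s : ℝ, s < 0 →
          MeasureTheory.eLpNorm (v s) 6 MeasureTheory.volume * ENNReal.ofReal ((-s) ^ (1 / 4 : ℝ)) ≤ η →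
          ∀ᵐ t ∂(MeasureTheory.volume.restrict (Set.Ioo s 0)),
            MeasureTheory.eLpNorm (v t) 6 MeasureTheory.volume ≤
              4 * MeasureTheory.eLpNorm (v s) 6 MeasureTheory.volume)
    (hO : ∀ v : ℝ → EuclideanSpace ℝ (Fin 3) → EuclideanSpace ℝ (Fin 3),
      Literature.Analysis.FluidPDE.IsBoundedAncientMildSolution 1 v →
      ContinuousOn (Function.uncurry v) (Set.Iio 0 ×ˢ Set.univ) →
      (∃ K : NNReal, ∀ s < 0, MeasureTheory.eLpNorm (v s) 6 MeasureTheory.volume ≤ K) →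
      ∀ s t : ℝ, s < t → t < 0 → ∀ x,
        v t x = Literature.Analysis.UnboundedOperators.heatExtension (v s) (t - s) x -
          Literature.Analysis.FluidPDE.oseenDuhamel 1 s v v t x)
    (hSob : ∃ K : NNReal, ∀ u : EuclideanSpace ℝ (Fin 3) → EuclideanSpace ℝ (Fin 3),
      ContDiff ℝ 1 u → MeasureTheory.MemLp u 6 MeasureTheory.volume →
      MeasureTheory.eLpNorm u 6 MeasureTheory.volume ≤
        (K : ENNReal) * (∫⁻ y, ENNReal.ofReal
          (Literature.Analysis.FluidPDE.frobeniusNormSq (fderiv ℝ u y))) ^ (1 / 2 : ℝ)) :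
    ∀ v : ℝ → EuclideanSpace ℝ (Fin 3) → EuclideanSpace ℝ (Fin 3),
      Literature.Analysis.FluidPDE.IsBoundedAncientMildSolution 1 v →
      ContDiffOn ℝ (⊤ : ℕ∞) (Function.uncurry v) (Set.Iio 0 ×ˢ Set.univ) →
      (∃ C : NNReal, ∀ s < 0, ∫⁻ y, ENNReal.ofReal
          (Literature.Analysis.FluidPDE.frobeniusNormSq (fderiv ℝ (v s) y)) ≤ C) →
      (∀ s < 0, MeasureTheory.MemLp (v s) 6 MeasureTheory.volume) →
      ∀ s < 0, ∀ y, v s y = 0 := by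
  intro v hv hsm hens hL6
  have hc : ContinuousOn (uncurry v) (Iio 0 ×ˢ univ) := hsm.continuousOn
  have h6 := eLpNorm_six_le_of_enstrophy hSob hsm hens hL6
  rcases hT v hv hsm hens hL6 with hA | ⟨τ, M, hMtop, hτ, hτ0, hτM⟩
  · -- GATE A: dips below the self-similar envelope at arbitrarily early times
    obtain ⟨η, hη0, hstab⟩ := hS
    -- good early times with smallness `≤ min η (k+1)⁻¹`
    have hsel : ∀ k : ℕ, ∃ σ : ℝ, σ < -((k : ℝ) + 1) ∧
        eLpNorm (v σ) 6 volume * ENNReal.ofReal ((-σ) ^ (1 / 4 : ℝ)) ≤ η ∧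
        eLpNorm (v σ) 6 volume ≤ ((k : ℝ≥0∞) + 1)⁻¹ := by
      intro k
      set m : ℝ≥0∞ := min η (((k : ℝ≥0∞) + 1)⁻¹) with hm
      have hm0 : 0 < m := lt_min hη0
        (ENNReal.inv_pos.2 (ENNReal.add_ne_top.2 ⟨ENNReal.natCast_ne_top k, ENNReal.one_ne_top⟩))
      have hε0 : 0 < m ^ (4 : ℝ) := ENNReal.rpow_pos_of_nonneg hm0 (by norm_num)
      obtain ⟨σ, hσR, hσε⟩ := hA (m ^ (4 : ℝ)) hε0 ((k : ℝ) + 1) (by positivity)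
      have hσ1 : 1 ≤ -σ := by
        have : (0 : ℝ) ≤ k := Nat.cast_nonneg k
        linarith
      obtain ⟨h1, h2⟩ := mul_rpow_le_of_rpow_mul_lt (l := 4) (by norm_num) hσ1 hσε
      exact ⟨σ, hσR, h1.trans (min_le_left _ _), h2.trans (min_le_right _ _)⟩
    choose σ hσ using hsel
    have hσ0 : ∀ k, σ k < 0 := fun k => by
      have h1 := (hσ k).1
      have : (0 : ℝ) ≤ k := Nat.cast_nonneg k
      linarith
    -- stability from each good time up to the final time
    have hwin : ∀ k : ℕ, ∀ᵐ t ∂(volume.restrict (Ioo (σ k) 0)),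
        eLpNorm (v t) 6 volume ≤ 4 * ((k : ℝ≥0∞) + 1)⁻¹ := by
      intro k
      filter_upwards [hstab v hv hc h6 (σ k) (hσ0 k) (hσ k).2.1] with t ht
      exact ht.trans (mul_le_mul' le_rfl (hσ k).2.2)
    have hall : ∀ᵐ t ∂(volume : Measure ℝ), ∀ k : ℕ, t ∈ Ioo (σ k) 0 →
        eLpNorm (v t) 6 volume ≤ 4 * ((k : ℝ≥0∞) + 1)⁻¹ := by
      rw [ae_all_iff]
      intro k
      exact (ae_restrict_iff' measurableSet_Ioo).1 (hwin k)
    -- hence `‖v(t)‖₆ = 0` for a.e. `t < 0`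
    have hae : ∀ᵐ t ∂((volume : Measure ℝ).restrict (Iio 0)),
        v t =ᵐ[(volume : Measure (EuclideanSpace ℝ (Fin 3)))] 0 := by
      refine (ae_restrict_iff' measurableSet_Iio).2 ?_
      filter_upwards [hall] with t ht ht0
      have hzero : eLpNorm (v t) 6 volume = 0 := by
        refine ENNReal.eq_zero_of_le_four_mul_inv_nat_succ fun m => ?_
        obtain ⟨n, hn⟩ := exists_nat_gt (-t)
        have hkt : σ (max m n) < t := by
          have h1 := (hσ (max m n)).1
          have h2 : (n : ℝ) ≤ ((max m n : ℕ) : ℝ) := by exact_mod_cast le_max_right m n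
          linarith
        have hmk : ((m : ℝ≥0∞) + 1)⁻¹ ≥ (((max m n : ℕ) : ℝ≥0∞) + 1)⁻¹ := by
          apply ENNReal.inv_le_inv.2
          gcongr
          exact_mod_cast le_max_left m n
        calc eLpNorm (v t) 6 volume ≤ 4 * (((max m n : ℕ) : ℝ≥0∞) + 1)⁻¹ := ht (max m n) ⟨hkt, ht0⟩
          _ ≤ 4 * ((m : ℝ≥0∞) + 1)⁻¹ := mul_le_mul' le_rfl hmk
      exact (eLpNorm_eq_zero_iff (continuous_slice hc ht0).aestronglyMeasurable (by norm_num)).1 hzero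
    exact eq_zero_of_ae_of_continuousOn hc hae
  · -- GATE B: bounded `L³` norms along a backward sequence of times
    have hoseen := hO v hv hc h6
    intro s hs y
    exact AlbrittonBarker2019_liouville_L3_backward_holds hc hv.2
      (fun t ht => hv.1.1 t ht) hoseen ⟨τ, M, hMtop, hτ, hτ0, hτM⟩ s hs y

/-- **The skeleton theorem (reshaping 4, SHARP two-gate): the crux BY NAME from the registered
stubs, used by name** — `stub_sharpTwoGate` (OPEN), the landed `stub_l6Stability` (p165798,
wave 2 of lead c2) and the landed `stub_oseenMildOfL6` (p164272), with the landed 2a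
`sobolevSixFrobenius`. The only open placeholder is `stub_sharpTwoGate`. (The compositions of
reshapings 1–3 — `parabolicGaldiLiouville_of_hyps`, `parabolicGaldiLiouville_of_hyps_sq`,
`parabolicGaldiLiouville_of_hyps_twoGate` — stay above, fully proved with their stubs as
hypotheses; each earlier open stub implies the present one: `sharpTwoGate_of_twoGate` ∘
`twoGate_of_sqIntegrableEnstrophy` ∘ `sqIntegrableEnstrophy_of_finiteDissipation`.) -/
theorem ParabolicGaldiLiouville_of : Theses.GaldiLiouvilleGate.ParabolicGaldiLiouville :=
  parabolicGaldiLiouville_of_hyps_sharpTwoGate stub_sharpTwoGate stub_l6Stability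
    stub_oseenMildOfL6 sobolevSixFrobenius

end Summit.NavierStokesRegularity.NavierStokesRegularity.Cruxes.ParabolicGaldiLiouville.Birth
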